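import Mathlib.MeasureTheory.Function.AbsolutelyContinuous
import Mathlib.MeasureTheory.Integral.IntervalIntegral.AbsolutelyContinuousFun
import Mathlib.MeasureTheory.Integral.IntervalIntegral.LebesgueDifferentiationThm
import Literature.Analysis.FluidPDE.ClassicalSolutionCalculus
import Literature.Analysis.FunctionSpaces.TimeMollification
import HarnessLib

/-!
# Tao (2011/2013), proof of Thm. 10.1: the total-speed integral `∫₀ᵗ ‖u(s)‖_{L^∞} ds`

A proved brick of the printed proof of Tao 2011, **Thm. 10.1** (arXiv:1108.1165, §10, p. 30).
The proof runs the energy method with a cutoff whose radius shrinks at the speed of the fluid,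
"Given this `R'`, we then define a time-dependent radius function
`R'(t) := R' − c⁻¹ ∫₀ᵗ ‖u(s)‖_{L^∞_x(ℝ³)} ds`. From Proposition 9.1 [bounded total speed] one has
`R'(t) ≥ R' − O_c(E₀ + E₀^{1/2}T^{1/4})`", the point being "to 'outrun' all difficulties caused
by the transport component" via the pointwise estimate (10.12)
`∂ₜη(t,x) ≤ −c⁻¹‖u(t)‖_{L^∞}|∇ₓη(t,x)|`. This file supplies the real-variable facts about the
**speed integral** `σ(t) = ∫₀ᵗ ‖u(s)‖_{L^∞_x} ds` of a classical solution on the closed slab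
`[0, T] × ℝ³` under the total-speed hypothesis `∫₀ᵀ ‖u(t)‖_{L^∞} dt ≤ M` (the form in which
Prop. 9.1 enters the a priori leaves `NS.tao2011_enstrophyLocalisation_*_apriori_unit`):

* `NS.eLpNorm_top_eq_iSup_enorm` — for a continuous slice, `‖v‖_{L^∞} = sup_x |v(x)|`
  (so Mathlib's essential supremum is the supremum Tao means; the nontrivial inequality is the
  tree's `Literature.Analysis.FunctionSpaces.enorm_le_eLpNorm_top_of_continuous`);
* `NS.aemeasurable_speed` — `t ↦ ‖u(t)‖_{L^∞}` is a.e.-measurable on `(0, T)` (the special case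
  `r = ∞`, `S = (0, T)` of the tree's `Literature.Analysis.FunctionSpaces.aemeasurable_eLpNorm_slice` for the jointly continuous
  field `u` on the slab); without this the lower Lebesgue integral in the hypothesis would not be
  the integral of a function one can differentiate;
* `NS.speedIntegral u t = ∫₀ᵗ ‖u(s)‖_{L^∞} ds` (real-valued, `def`) and, under
  `∫₀ᵀ ‖u‖_{L^∞} ≤ M`: finiteness of the speed for a.e. `t`, integrability of
  `t ↦ ‖u(t)‖_{L^∞}` on `[0, T]`, `σ(0) = 0`, `0 ≤ σ ≤ M`, monotonicity, continuity and
  **absolute continuity** of `σ` on `[0, T]`, and `σ'(t) = ‖u(t)‖_{L^∞}` for a.e. `t ∈ [0, T]`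
  (Lebesgue differentiation) — `σ` is in general *not* `C¹` (the speed is merely integrable),
  which is why the enstrophy inequality of §10 is integrated in time
  (`TaoEnstrophyContinuity.lean`, `…_integral`);
* `NS.norm_le_speed` — `|u(t, x)| ≤ ‖u(t)‖_{L^∞}` pointwise whenever the right side is finite.

## Mathlib / tree search

Tree: `Literature.Analysis.FunctionSpaces.enorm_le_eLpNorm_top_of_continuous` (`FunctionSpaces/SobolevDomainProofs`, in the
import closure of `ClassicalSolutionCalculus`) is the inequality `|v(x)| ≤ ‖v‖_{L^∞}` for
continuous `v`, used for `eLpNorm_top_eq_iSup_enorm`; `Literature.Analysis.FunctionSpaces.measurable_eLpNorm_slice` /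
`Literature.Analysis.FunctionSpaces.aemeasurable_eLpNorm_slice` (`FunctionSpaces/TimeMollification`) give the (a.e.)
measurability of `s ↦ ‖u(s)‖_{L^r}` for (a.e.) jointly strongly measurable fields and any
exponent, used for `aemeasurable_speed`; nothing on `L¹_t L^∞_x` speeds
(`lean search 'speed|L1Linfty|eLpNorm.*⊤.*Ioo'`). Mathlib: `integrable_toReal_of_lintegral_ne_top`,
`IntervalIntegrable.absolutelyContinuousOnInterval_intervalIntegral`,
`IntervalIntegrable.ae_hasDerivAt_integral` (Lebesgue differentiation theorem).

## References

* T. Tao, *Localisation and compactness properties of the Navier–Stokes global regularity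
  problem*, Anal. PDE 6 (2013) 25–107 = arXiv:1108.1165 (`Tao2011`), §10, proof of Thm. 10.1
  (arXiv p. 30: definition of `R'(t)`; p. 31: (10.12)); Prop. 9.1 (arXiv Prop. 52).
-/

noncomputable section

open MeasureTheory Set Function Filter Topology intervalIntegral
open scoped ENNReal NNReal

namespace Literature.Analysis.FluidPDE

/-- Local notation for physical space `ℝ³ = EuclideanSpace ℝ (Fin 3)`. -/
local notation "ℝ³" => EuclideanSpace ℝ (Fin 3)

/-! ## The `L^∞` norm of a continuous slice is its supremum -/

/-- For a continuous function on a space whose measure charges every nonempty open set (e.g.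
Lebesgue measure on `ℝ³`), the `L^∞` (essential supremum) norm is the supremum:
`‖v‖_{L^∞(μ)} = sup_x ‖v(x)‖` (the inequality `≥` is the tree's
`Literature.Analysis.FunctionSpaces.enorm_le_eLpNorm_top_of_continuous`). [folklore] -/
theorem eLpNorm_top_eq_iSup_enorm {X : Type*} [TopologicalSpace X] [MeasurableSpace X]
    [OpensMeasurableSpace X] (μ : Measure X) [μ.IsOpenPosMeasure] {F : Type*}
    [NormedAddCommGroup F] {v : X → F} (hv : Continuous v) :
    eLpNorm v ∞ μ = ⨆ x, ‖v x‖ₑ := by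
  refine le_antisymm ?_ (iSup_le fun x => Literature.Analysis.FunctionSpaces.enorm_le_eLpNorm_top_of_continuous μ hv x)
  rw [eLpNorm_exponent_top]
  exact essSup_le_of_ae_le _ (ae_of_all _ fun x => le_iSup (fun y => ‖v y‖ₑ) x)

/-- Pointwise bound by the speed: `‖u(t, x)‖ ≤ ‖u(t)‖_{L^∞}` for a continuous slice, in `ℝ`
whenever the `L^∞` norm is finite. [folklore] -/
theorem norm_le_speed {F : Type*} [NormedAddCommGroup F] {v : ℝ³ → F} (hv : Continuous v)
    (hfin : eLpNorm v ∞ volume < ∞) (x : ℝ³) : ‖v x‖ ≤ (eLpNorm v ∞ volume).toReal := by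
  have h : ‖v x‖ₑ ≤ eLpNorm v ∞ volume := by
    rw [eLpNorm_top_eq_iSup_enorm volume hv]
    exact le_iSup (fun y => ‖v y‖ₑ) x
  rw [← ofReal_norm] at h
  exact (ENNReal.ofReal_le_iff_le_toReal hfin.ne).1 h

/-! ## Measurability of the speed `t ↦ ‖u(t)‖_{L^∞}` -/

/-- **The speed of a classical solution is a.e.-measurable in time.** For `u` jointly smooth
(hence continuous) on the closed slab `[0, T] × ℝ³`, `t ↦ ‖u(t)‖_{L^∞_x}` is a.e.-measurable
on `(0, T)`: the special case `r = ∞`, `S = (0, T)` of the tree's `Literature.Analysis.FunctionSpaces.aemeasurable_eLpNorm_slice`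
(any a.e. jointly strongly measurable field, any exponent), the field being continuous on
`(0, T) × ℝ³`. [folklore] -/
theorem aemeasurable_speed {T : ℝ} {u : ℝ → ℝ³ → ℝ³} (hu : FluidPDE.IsSmoothSpaceTimeOn (Icc 0 T) u) :
    AEMeasurable (fun t => eLpNorm (u t) ∞ volume) (volume.restrict (Ioo 0 T)) := by
  have hc : ContinuousOn (uncurry u) (Ioo 0 T ×ˢ (univ : Set ℝ³)) :=
    hu.continuousOn.mono (prod_mono Ioo_subset_Icc_self subset_rfl)
  have hae : AEStronglyMeasurable (uncurry u)
      ((volume : Measure (ℝ × ℝ³)).restrict (Ioo 0 T ×ˢ (univ : Set ℝ³))) :=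
    hc.aestronglyMeasurable (measurableSet_Ioo.prod MeasurableSet.univ)
  rw [Measure.volume_eq_prod, ← Measure.prod_restrict, Measure.restrict_univ] at hae
  exact Literature.Analysis.FunctionSpaces.aemeasurable_eLpNorm_slice hae ∞

/-! ## The speed integral `σ(t) = ∫₀ᵗ ‖u(s)‖_{L^∞} ds` -/

/-- The real-valued speed `t ↦ ‖u(t)‖_{L^∞_x}` (junk value `0` at times of infinite speed, a
null set under the total-speed hypothesis). [cite: Tao2011, §10, proof of Thm. 10.1 (definition of `R'(t)`)] -/
def speed (u : ℝ → ℝ³ → ℝ³) (t : ℝ) : ℝ := (eLpNorm (u t) ∞ volume).toReal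

/-- **Tao's speed integral** `σ(t) = ∫₀ᵗ ‖u(s)‖_{L^∞_x(ℝ³)} ds`, the quantity by which the cutoff
radius `R'(t) = R' − c⁻¹σ(t)` of the proof of Thm. 10.1 shrinks. [cite: Tao2011, §10, proof of Thm. 10.1 (definition of `R'(t)`)] -/
def speedIntegral (u : ℝ → ℝ³ → ℝ³) (t : ℝ) : ℝ := ∫ s in (0)..t, speed u s

/-- Unfolding `speed`. [folklore] -/
theorem speed_def (u : ℝ → ℝ³ → ℝ³) (t : ℝ) : speed u t = (eLpNorm (u t) ∞ volume).toReal := rfl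

/-- Unfolding `speedIntegral`. [folklore] -/
theorem speedIntegral_def (u : ℝ → ℝ³ → ℝ³) (t : ℝ) :
    speedIntegral u t = ∫ s in (0)..t, speed u s := rfl

/-- The speed is nonnegative. [folklore] -/
theorem speed_nonneg (u : ℝ → ℝ³ → ℝ³) (t : ℝ) : 0 ≤ speed u t := ENNReal.toReal_nonneg

/-- `σ(0) = 0`. [folklore] -/
@[simp] theorem speedIntegral_zero (u : ℝ → ℝ³ → ℝ³) : speedIntegral u 0 = 0 := by
  simp [speedIntegral]

section TotalSpeed

variable {T M : ℝ} {u : ℝ → ℝ³ → ℝ³}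

/-- Under the total-speed hypothesis `∫₀ᵀ ‖u‖_{L^∞} ≤ M`, the speed is finite for a.e.
`t ∈ (0, T)`. [folklore] -/
theorem ae_speed_lt_top (hu : FluidPDE.IsSmoothSpaceTimeOn (Icc 0 T) u)
    (hMt : ∫⁻ t in Ioo 0 T, eLpNorm (u t) ∞ volume ≤ ENNReal.ofReal M) :
    ∀ᵐ t ∂(volume.restrict (Ioo 0 T)), eLpNorm (u t) ∞ volume < ∞ :=
  ae_lt_top' (aemeasurable_speed hu) (hMt.trans_lt ENNReal.ofReal_lt_top).ne

/-- Under the total-speed hypothesis, the real speed is integrable on `(0, T)`. [folklore] -/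
theorem integrableOn_speed (hu : FluidPDE.IsSmoothSpaceTimeOn (Icc 0 T) u)
    (hMt : ∫⁻ t in Ioo 0 T, eLpNorm (u t) ∞ volume ≤ ENNReal.ofReal M) :
    IntegrableOn (speed u) (Ioo 0 T) :=
  integrable_toReal_of_lintegral_ne_top (aemeasurable_speed hu)
    (hMt.trans_lt ENNReal.ofReal_lt_top).ne

/-- Under the total-speed hypothesis, the real speed is interval integrable on `[0, T]`. [folklore] -/
theorem intervalIntegrable_speed (hT : 0 < T) (hu : FluidPDE.IsSmoothSpaceTimeOn (Icc 0 T) u)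
    (hMt : ∫⁻ t in Ioo 0 T, eLpNorm (u t) ∞ volume ≤ ENNReal.ofReal M) :
    IntervalIntegrable (speed u) volume 0 T := by
  rw [intervalIntegrable_iff_integrableOn_Ioo_of_le hT.le]
  exact integrableOn_speed hu hMt

/-- The total speed integral is at most `M`: `σ(T) = ∫₀ᵀ ‖u‖_{L^∞} ≤ M` (for `M ≥ 0`). [folklore] -/
theorem speedIntegral_le (hT : 0 < T) (hM : 0 ≤ M) (hu : FluidPDE.IsSmoothSpaceTimeOn (Icc 0 T) u)
    (hMt : ∫⁻ t in Ioo 0 T, eLpNorm (u t) ∞ volume ≤ ENNReal.ofReal M) :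
    speedIntegral u T ≤ M := by
  rw [speedIntegral_def, integral_of_le hT.le, integral_Ioc_eq_integral_Ioo]
  simp only [speed_def]
  rw [integral_toReal (aemeasurable_speed hu) (ae_speed_lt_top hu hMt)]
  exact ENNReal.toReal_le_of_le_ofReal hM hMt

/-- Monotonicity of the speed integral on `[0, T]`: `σ(s) ≤ σ(t)` for `0 ≤ s ≤ t ≤ T`, and
`σ(t) − σ(s) = ∫ₛᵗ ‖u‖_{L^∞}`. [folklore] -/
theorem speedIntegral_sub_eq (hT : 0 < T) (hu : FluidPDE.IsSmoothSpaceTimeOn (Icc 0 T) u)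
    (hMt : ∫⁻ t in Ioo 0 T, eLpNorm (u t) ∞ volume ≤ ENNReal.ofReal M) {s t : ℝ}
    (hs : 0 ≤ s) (hst : s ≤ t) (ht : t ≤ T) :
    speedIntegral u t - speedIntegral u s = ∫ τ in s..t, speed u τ := by
  have hi := intervalIntegrable_speed hT hu hMt
  rw [speedIntegral_def, speedIntegral_def]
  exact integral_interval_sub_left
    (hi.mono_set (by
      rw [uIcc_of_le hT.le, uIcc_of_le (hs.trans hst)]; exact Icc_subset_Icc le_rfl ht))
    (hi.mono_set (by
      rw [uIcc_of_le hT.le, uIcc_of_le hs]; exact Icc_subset_Icc le_rfl (hst.trans ht)))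

/-- The speed integral is nondecreasing on `[0, T]`. [folklore] -/
theorem speedIntegral_mono (hT : 0 < T) (hu : FluidPDE.IsSmoothSpaceTimeOn (Icc 0 T) u)
    (hMt : ∫⁻ t in Ioo 0 T, eLpNorm (u t) ∞ volume ≤ ENNReal.ofReal M) :
    MonotoneOn (speedIntegral u) (Icc 0 T) := by
  intro s hs t ht hst
  have h := speedIntegral_sub_eq hT hu hMt hs.1 hst ht.2
  have h0 : 0 ≤ ∫ τ in s..t, speed u τ := integral_nonneg hst fun τ _ => speed_nonneg u τ
  linarith

/-- `0 ≤ σ(t)` on `[0, T]` (the upper bound `σ(t) ≤ M` is `speedIntegral_le_of_mem`). [folklore] -/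
theorem speedIntegral_nonneg (hT : 0 < T) (hu : FluidPDE.IsSmoothSpaceTimeOn (Icc 0 T) u)
    (hMt : ∫⁻ t in Ioo 0 T, eLpNorm (u t) ∞ volume ≤ ENNReal.ofReal M) {t : ℝ} (ht : t ∈ Icc 0 T) :
    0 ≤ speedIntegral u t := by
  have := speedIntegral_mono hT hu hMt ⟨le_rfl, hT.le⟩ ht ht.1
  rwa [speedIntegral_zero] at this

/-- `σ(t) ≤ M` for `t ∈ [0, T]`. [folklore] -/
theorem speedIntegral_le_of_mem (hT : 0 < T) (hM : 0 ≤ M) (hu : FluidPDE.IsSmoothSpaceTimeOn (Icc 0 T) u)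
    (hMt : ∫⁻ t in Ioo 0 T, eLpNorm (u t) ∞ volume ≤ ENNReal.ofReal M) {t : ℝ} (ht : t ∈ Icc 0 T) :
    speedIntegral u t ≤ M :=
  (speedIntegral_mono hT hu hMt ht ⟨hT.le, le_rfl⟩ ht.2).trans (speedIntegral_le hT hM hu hMt)

/-- The speed integral is continuous on `[0, T]`. [folklore] -/
theorem continuousOn_speedIntegral (hT : 0 < T) (hu : FluidPDE.IsSmoothSpaceTimeOn (Icc 0 T) u)
    (hMt : ∫⁻ t in Ioo 0 T, eLpNorm (u t) ∞ volume ≤ ENNReal.ofReal M) :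
    ContinuousOn (speedIntegral u) (Icc 0 T) := by
  have hi := intervalIntegrable_speed hT hu hMt
  have hint : IntegrableOn (speed u) (uIcc 0 T) volume := by
    rw [uIcc_of_le hT.le]
    exact (integrableOn_speed hu hMt).congr_set_ae Ioo_ae_eq_Icc.symm
  have := continuousOn_primitive_interval (μ := volume) hint
  rw [uIcc_of_le hT.le] at this
  exact this

/-- **The speed integral is absolutely continuous on `[0, T]`** (a primitive of an integrable
function); it is in general not `C¹`. [folklore] -/
theorem absolutelyContinuousOnInterval_speedIntegral (hT : 0 < T)
    (hu : FluidPDE.IsSmoothSpaceTimeOn (Icc 0 T) u)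
    (hMt : ∫⁻ t in Ioo 0 T, eLpNorm (u t) ∞ volume ≤ ENNReal.ofReal M) :
    AbsolutelyContinuousOnInterval (speedIntegral u) 0 T :=
  (intervalIntegrable_speed hT hu hMt).absolutelyContinuousOnInterval_intervalIntegral
    (by rw [uIcc_of_le hT.le]; exact ⟨le_rfl, hT.le⟩)

/-- **Lebesgue differentiation:** `σ'(t) = ‖u(t)‖_{L^∞}` for a.e. `t ∈ [0, T]`. [folklore] -/
theorem ae_hasDerivAt_speedIntegral (hT : 0 < T) (hu : FluidPDE.IsSmoothSpaceTimeOn (Icc 0 T) u)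
    (hMt : ∫⁻ t in Ioo 0 T, eLpNorm (u t) ∞ volume ≤ ENNReal.ofReal M) :
    ∀ᵐ t, t ∈ Icc 0 T → HasDerivAt (speedIntegral u) (speed u t) t := by
  have h := (intervalIntegrable_speed hT hu hMt).ae_hasDerivAt_integral
  rw [uIcc_of_le hT.le] at h
  filter_upwards [h] with t ht htI
  exact ht htI 0 ⟨le_rfl, hT.le⟩

/-- Pointwise control by the speed at a.e. time: for a.e. `t ∈ (0, T)` and every `x`,
`‖u(t, x)‖ ≤ ‖u(t)‖_{L^∞}` with a finite right-hand side. [folklore] -/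
theorem ae_norm_le_speed (hu : FluidPDE.IsSmoothSpaceTimeOn (Icc 0 T) u)
    (hMt : ∫⁻ t in Ioo 0 T, eLpNorm (u t) ∞ volume ≤ ENNReal.ofReal M) :
    ∀ᵐ t ∂(volume.restrict (Ioo 0 T)), ∀ x, ‖u t x‖ ≤ speed u t := by
  filter_upwards [ae_speed_lt_top hu hMt, ae_restrict_mem measurableSet_Ioo] with t ht htI x
  exact norm_le_speed (hu.contDiff_slice (Ioo_subset_Icc_self htI)).continuous ht x

end TotalSpeed

end Literature.Analysis.FluidPDE

end
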